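import Summits.QuantumFields.BalabanUV.Beta.FP.StepRecursionFeedNestedCompDoorMoments
import Summits.QuantumFields.BalabanUV.Beta.FP.TowerK2bDoorReadoutMoments

/-!
# `BalabanUV.Beta.FP.StepRecursionFeedNestedCompDoorPairing` — road «FP» for binder row D1: **THE END AT THE BASE WITH THE DOOR TADPOLE DISPLAYED AS THE COVARIANT
# SYMMETRISED PAIRING — an4's three base folds DISCHARGED BY NAME from the row's PART 41∕42 under the three record-side letters (U) «no door word on the summed gauge
# column» (`hΘ`), (C) «the read-out column is co-closed» (`hdiv`), (R) «reflection parities» — SO THAT THE ROW's ONE-FILE SKELETON (LEMMA U ∕ C ∕ R + the identification)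
# PLUGS INTO `D1Tel` WITH NO MOMENT ROW LEFT DISPLAYED** (SPEC-64 §12 (4)(a) wording, an2 A-4∕A-5; `…CompDoorMoments` p659244 + an2 PART 41 p659076 ∕ PART 42 BY NAME)

WHY.  `…CompDoorMoments` §3 (p659244) concludes `D1Tel` at the record pair from the door data, the fed transport `htrΔ`, the covariance row `hDΔtr`, and the THREE LATTICE FOLDS OF THE
RAW DOOR TADPOLE AT THE BASE `hM0₁ hM1₁ hM2₁` (`∑' z, τ = 0`, `∑' z, z_ρ·τ = 0`, `∑' z, z_κ z_λ·τ = 0`, `τ(c,e,z) := tadpole (AN 1)(𝒲Δ 1 c 0 e z)`).  The row's PART 41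
(`TowerK2bDoorTadpoleMoments`) and PART 42 (`TowerK2bDoorReadoutMoments`) prove, for the COVARIANT SYMMETRISED WINDOW PAIRING
`X((μ,0),(ν,z)) := Σ_κ Σ_{y∈W} (Ŝ_{(ν,z)}(κ,y)·τ_{(κ,y)}(λ_{(μ,0)}) + Ŝ_{(μ,0)}(κ,y)·τ_{(κ,y)}(λ_{(ν,z)}))` on any lattice `G` (finite windows, joint translation covariance), that
ALL its lattice moments of order ≤ 2 vanish — `HasSum X 0`, `HasSum (c·X) 0`, `HasSum (c c′·X) 0` for every source pair — as soon as (U) every door-word column sums to zero (`hΘ`), (C) every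
read-out column `Ŝ_{(ν,0)}` is a CO-CLOSED lattice 1-form (`hdiv`: summation by parts kills its column sums and longitudinal dipoles and antisymmetrises the transverse ones) and (R) the
read-out columns are REFLECTION-EVEN across the hyperplanes transverse to the source (kills the remaining dipoles).  By value at n = 0 all three are located or registered (K2L-LAM: `Λ_μ`
constant ⇒ `hΘ`; K1 §6: the φ-column is coarse co-closed; the mirror parities of the centred-root construction; PREDICTION-AN2-75-Z ∕ -FP-52-Z before K2L-M2P7), zero weight.  THIS FILE
types the junction: §3's END with `hM0₁ hM1₁ hM2₁` REPLACED by the pairing data at the base, the identification `hX : tadpole (AN 1)(𝒲Δ 1 c 0 e z) = X((c,0),(e,z))` ((T2)'s shape — the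
row's ONE file proves it from `def_allDepths` + PART 37∕38), and the letters `hΘ` (U), `hdiv` (C), `hRW hRA hRc` (R) — exactly the three stubs of the row's announced skeleton (an2 A-4 (5)).
Consumer class: composition BY NAME; no law, no v10, nothing on the H-side (policy SPEC-64 §10 (4) ∕ §12 unchanged).

WHAT.  Blocking `Lc` (`[NeZero Lc]`, `Odd Lc`), dimension four, lattice `G := Site (3+1)`, directions `D := Fin (3+1)`, gauge-column space `V` (any real module).
* §1 [folklore] `tsum_weight_tadpole_eq_zero_of_hasSum` — the one-token bridge: `HasSum (z ↦ ω z·X z) 0` and `τ = X` pointwise ⟹ `∑' z, ω z·τ z = 0`.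
* §2 [folklore] **`d1Tel_JcComp_ctr_nested_of_fedW_pairing_fed_wStep`** (+ the `D1Sum` read-out twin): `…CompDoorMoments` §3's rows `hWΔ₂ hlawΔ hF₁ htrΔ hG hT0 hT1 hDΔtr` VERBATIM; the base
  folds REPLACED by: the pairing data `S τ λ` on windows `W ⊆ Y`, relative positions `Z ⊇ W − W`, unit steps `e`, lattice coordinates `c ρ` (`c ρ z = z_ρ`, `c ρ (e κ) = [κ = ρ]`),
  covariance `hS hτ`, supports `hSW hτW`; (U) `hΘ`; (C) `hdiv`; (R) per source direction `ν` and every `ρ ≠ ν` a window-preserving bijection `R ν ρ` leaving the components `κ ≠ ρ`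
  invariant and flipping `c ρ` affinely; and the identification `hX`.  Inside: `hS0` from PART 42 `colSum_eq_zero_of_coclosed`, all read-out dipoles from
  `dipoles_eq_zero_of_coclosed_of_reflect`, then PART 41 `hasSum_zerothMoment_symPairing`, PART 42 `hasSum_firstMoment_symPairing_of_colSums_eq_zero` ∕
  `hasSum_secondMoment_symPairing_of_dipoles_eq_zero`, §1, and p659244 §3.
* §3 (v1.1) [folklore] **`d1Tel_JcComp_nested_of_fedW_pairing_wStep`** — the PER-STOREY shape (`…CompDoorMoments` §2: no fed door transport, NO covariance row `hDΔtr`, no G3):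
  the pairing data, (U)(C)(R) and `hX j` AT EVERY STOREY `j ≥ 1` (storey-indexed windows `W j`, `Z j`, `Y j`, gauge-column spaces `V j`, reflections `R j`); the three letters are
  depth-free in shape (an2 A-3 (3) ∕ A-4 (5)).
[folklore] composition BY NAME; no `def`, no `def … : Prop`, nothing cited, 0 sorry.  Every displayed row is a HYPOTHESIS; (U)(C)(R) and `hX` are NOT discharged here (the row's ONE
file: LEMMA U ∕ C ∕ R + (T2)); nothing of the dictionary ∕ Bałaban's asserted, valued or discharged; NO moment claimed to vanish AT THE RECORD (what vanishes here vanishes from displayed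
letters, by the row's typed identities); the STEPS still ride on `hDΔtr` (G3); targets `D1Tel`∕`D1Sum` UNCHANGED; NOT a law file; no existing file touched.

HONEST DEPENDENCY (page 1, mandatory): continuum YM on T⁴ ⇐ BetaPertH ∧ nine spine estimates (0/9 proved); BetaPertH ⇐ (D1) ∧ (D4) ∧ CAP+tail;
G-an2-4 gates asym, D1 and NE2/3/4.  HONEST FRAMING (cell contract, verbatim): «discharging `BetaPertH` makes Bałaban's UV stability UNCONDITIONAL —
a real constructive-QFT result; it is NOT the continuum limit and NOT the Clay problem.»  ABSOLUTE RULE (cell charter, verbatim): «No internally-minted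
statement may enter as a cited fact. Every hypothesis is either kernel-proved in this package or a verbatim quotation of a PUBLISHED theorem with page
reference. The manuscript(s) under audit are NOT citable for their own disputed steps — they are the thing under adjudication; programme-internal
(2001/route/tribunal) claims are never citable.»  0 estimates; 0∕4 row-D1 binders (hW, hR, D1Tel, D1Rep); ROOT M‴ p325680 untouched; NOT (C1), NOT (L2′)
beyond `hN`'s name, NOT (T-ID), NOT SDF, NOT D1, NEVER «G-an2-4 closed», NOT BetaPertH, NOT continuum, NOT Clay.  Road «FP» OWNER, b2b-balaban-beta-d1-p3
gen 52, 2026-08-28.  No existing file touched.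
-/

noncomputable section

namespace Summit.QuantumFields.BalabanUV.Beta.FP.StepRecursionFeedNestedCompDoorPairing

open Finset
open Literature.MathematicalPhysics.QuantumFieldTheory
open Literature.MathematicalPhysics.QuantumFieldTheory.Balaban1983to89
open Literature.MathematicalPhysics.QuantumFieldTheory.Balaban1983to89.Beta
open DressedMomentNormalisation (EKer dressedEntry)
open ExpKernelCalculus (Site MKer tadpole hessKer VertexFamily₂)
open OneStepResolventKernel (Fib JetData)
open OneStepKernelFamily (TshotOf TbalOf D1Tel)
open HessianTelescopingKKT (wStep)
open StepDriftWitness (D1Sum)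
open Summit.QuantumFields.BalabanUV.Beta.SymSecondOrderTablesAn1 (symTablesAn1S2)
open Summit.QuantumFields.BalabanUV.Beta.CombChartJointEnd (JsB12CombShSym)
open Summit.QuantumFields.BalabanUV.Beta.CompositeOneShotJetData (Roots Pins JcComp AN VN WN)
open Summit.QuantumFields.BalabanUV.Beta.FP.StepRecursionFeedNestedCompDoorMoments
  (d1Tel_JcComp_ctr_nested_of_fedW_moments_fed_wStep d1Sum_JcComp_ctr_nested_of_fedW_moments_fed_wStep)
open Summit.QuantumFields.BalabanUV.Beta.FP.TowerK2bDoorTadpoleMoments (hasSum_zerothMoment_symPairing)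
open Summit.QuantumFields.BalabanUV.Beta.FP.TowerK2bDoorReadoutMoments
  (colSum_eq_zero_of_coclosed dipoles_eq_zero_of_coclosed_of_reflect hasSum_firstMoment_symPairing_of_colSums_eq_zero
    hasSum_secondMoment_symPairing_of_dipoles_eq_zero)

/-! ## §1 The one-token bridge from the row's `HasSum` rows to the END's `tsum` folds -/

section Bridge

variable {G : Type*}

/-- [folklore] if the weighted pairing has sum `0` on the lattice and the door tadpole IS the pairing pointwise, the weighted lattice fold of the tadpole vanishes. -/
theorem tsum_weight_tadpole_eq_zero_of_hasSum {ω X τ : G → ℝ} (h : HasSum (fun z => ω z * X z) 0) (hX : ∀ z, τ z = X z) :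
    ∑' z, ω z * τ z = 0 := by
  rw [show (fun z => ω z * τ z) = fun z => ω z * X z from funext fun z => by rw [hX z]]
  exact h.tsum_eq

/-- [folklore] unweighted twin. -/
theorem tsum_tadpole_eq_zero_of_hasSum {X τ : G → ℝ} (h : HasSum X 0) (hX : ∀ z, τ z = X z) : ∑' z, τ z = 0 := by
  rw [show τ = X from funext hX]
  exact h.tsum_eq

end Bridge

/-! ## §2 The END at the base with the door tadpole displayed as the covariant symmetrised pairing and the letters (U)(C)(R) -/

section BasePairing

variable {Lc : ℕ} [NeZero Lc] {FF FG : Type*} [Fintype FF] [Fintype FG] {V : Type*} [AddCommGroup V] [Module ℝ V]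

/-- [folklore] **ROOT M‴'s `htel` AT THE RECORD PAIR, THE DOOR A LOCALISED FAMILY FED CONSISTENTLY, ITS BASE TADPOLE DISPLAYED AS THE COVARIANT SYMMETRISED PAIRING UNDER
(U)(C)(R)** (`…CompDoorMoments` §3 shape; SPEC-64 §12 (4)(a)).  DISPLAYED: `𝒲Δ`, `hWΔ₂`, `hlawΔ`, `hF₁`, `htrΔ`, `hG` (T0)(T1), `hDΔtr` VERBATIM from p659244 §3; AT THE BASE, in place
of the three folds: read-out columns `S ν z κ y` (`Ŝ_{(ν,z)}(κ,y)`), door words `τ κ y : V →ₗ[ℝ] ℝ`, gauge columns `λ μ z : V`, window `W ⊆ Y`, relative positions `Z ⊇ W − W`, unit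
steps `e κ`, lattice coordinates `c ρ` (`hcz : c ρ z = z ρ`, `hce : c ρ (e κ) = [κ = ρ]`); joint covariance `hS hτ`, supports `hSW hτW`; (U) `hΘ : Σ_{y∈W} τ_{(κ,y)}(λ_{(μ,0)}) = 0`;
(C) `hdiv : Σ_κ (Ŝ_{(ν,0)}(κ,y) − Ŝ_{(ν,0)}(κ,y − e κ)) = 0` on `Y`; (R) reflections `R ν ρ` (`ρ ≠ ν`) preserving `W`, fixing the components `κ ≠ ρ` of `Ŝ_{(ν,0)}`, flipping `c ρ`
affinely; and THE IDENTIFICATION `hX : tadpole (AN 1)(𝒲Δ 1 μ 0 ν z) = X((μ,0),(ν,z))` ⟹ `D1Tel Lc Js (JcComp hLc N cΛ cB (Roots.ctr Lc) P)`. -/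
theorem d1Tel_JcComp_ctr_nested_of_fedW_pairing_fed_wStep (hLc : Odd Lc) (N : ℕ) (cΛ cB : ℝ) (P : Pins)
    (AF : ℕ → MKer 4 FF) (𝒱F : ℕ → Fin 4 → (Fin 4 → ℤ) → MKer 4 FF) (𝒲F : ℕ → Fin 4 → (Fin 4 → ℤ) → Fin 4 → (Fin 4 → ℤ) → MKer 4 FF)
    (AG : ℕ → MKer 4 FG) (𝒱G : ℕ → Fin 4 → (Fin 4 → ℤ) → MKer 4 FG) (𝒲G : ℕ → Fin 4 → (Fin 4 → ℤ) → Fin 4 → (Fin 4 → ℤ) → MKer 4 FG)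
    (𝒲Δ : ℕ → Fin (3 + 1) → Site (3 + 1) → Fin (3 + 1) → Site (3 + 1) → MKer (3 + 1) (Fib 3))
    (hWΔ₂ : ∀ j : ℕ, ∃ Cw δw : ℝ, 0 < δw ∧ VertexFamily₂ (𝒲Δ j) (Lc ^ (j + 1)) Cw δw)
    (hlawΔ : ∀ j : ℕ, 1 ≤ j → ∀ (μ ν : Fin 4) (z : Fin 4 → ℤ),
      hessKer (AN (Roots.ctr Lc) j) (VN (Roots.ctr Lc) P j) (WN (Roots.ctr Lc) P j + 𝒲Δ j) μ ν z
        = hessKer (AF j) (𝒱F j) (𝒲F j) μ ν z + hessKer (AG j) (𝒱G j) (𝒲G j) μ ν z)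
    (hF₁ : ∀ (μ ν : Fin 4) (z : Fin 4 → ℤ),
      hessKer (AF 1) (𝒱F 1) (𝒲F 1) μ ν z
        = (Lc : ℝ) ^ 8 * dressedEntry (wStep Lc 1) (TshotOf Lc (JcComp hLc N cΛ cB (Roots.ctr Lc) P) 1) ((Lc : ℤ) • z) μ ν)
    (htrΔ : ∀ j : ℕ, 1 ≤ j → ∀ (μ ν : Fin 4) (z : Fin 4 → ℤ),
      hessKer (AF (j + 1)) (𝒱F (j + 1)) (𝒲F (j + 1)) μ ν z
        = (Lc : ℝ) ^ 8 * dressedEntry (wStep Lc (j + 1))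
            (hessKer (AN (Roots.ctr Lc) j) (VN (Roots.ctr Lc) P j) (WN (Roots.ctr Lc) P j + 𝒲Δ j)) ((Lc : ℤ) • z) μ ν)
    (hG : ∀ j : ℕ, 1 ≤ j → ∀ (μ ν : Fin 4) (z : Fin 4 → ℤ),
      hessKer (AG j) (𝒱G j) (𝒲G j) μ ν z = TbalOf Lc (JsB12CombShSym hLc N (symTablesAn1S2 3 Lc cΛ) cΛ cB) j μ ν z)
    (hT0 : ∀ j (c e : Fin 4), HasSum (TbalOf Lc (JsB12CombShSym hLc N (symTablesAn1S2 3 Lc cΛ) cΛ cB) j c e) 0)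
    (hT1 : ∀ j (c e ρ : Fin 4), HasSum (fun t : Fin 4 → ℤ => t ρ • TbalOf Lc (JsB12CombShSym hLc N (symTablesAn1S2 3 Lc cΛ) cΛ cB) j c e t) 0)
    (hDΔtr : ∀ j : ℕ, 1 ≤ j → ∀ (μ ν : Fin 4) (z : Fin 4 → ℤ),
      -(1 / 2 : ℝ) * tadpole (AN (Roots.ctr Lc) (j + 1)) (𝒲Δ (j + 1) μ 0 ν z)
        = (Lc : ℝ) ^ 8 * dressedEntry (wStep Lc (j + 1))
            (fun c e t => -(1 / 2 : ℝ) * tadpole (AN (Roots.ctr Lc) j) (𝒲Δ j c 0 e t)) ((Lc : ℤ) • z) μ ν)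
    -- THE DOOR TADPOLE AT THE BASE AS THE COVARIANT SYMMETRISED PAIRING: read-out columns, door words, gauge columns; windows, steps, coordinates
    (S : Fin (3 + 1) → Site (3 + 1) → Fin (3 + 1) → Site (3 + 1) → ℝ) (τ : Fin (3 + 1) → Site (3 + 1) → V →ₗ[ℝ] ℝ) (lam : Fin (3 + 1) → Site (3 + 1) → V)
    (W Z Y : Finset (Site (3 + 1))) (hZ : ∀ y ∈ W, ∀ w ∈ W, y - w ∈ Z) (hWY : ∀ w ∈ W, w ∈ Y)
    (e : Fin (3 + 1) → Site (3 + 1)) (hWY' : ∀ (κ : Fin (3 + 1)), ∀ w ∈ W, w + e κ ∈ Y)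
    (c : Fin (3 + 1) → Site (3 + 1) →+ ℝ) (hcz : ∀ (ρ : Fin (3 + 1)) (z : Site (3 + 1)), c ρ z = (z ρ : ℝ))
    (hce : ∀ (ρ κ : Fin (3 + 1)), c ρ (e κ) = if κ = ρ then 1 else 0)
    (hS : ∀ (ν : Fin (3 + 1)) (z : Site (3 + 1)) (κ : Fin (3 + 1)) (y : Site (3 + 1)), S ν z κ y = S ν 0 κ (y - z))
    (hτ : ∀ (κ : Fin (3 + 1)) (y : Site (3 + 1)) (μ : Fin (3 + 1)) (z : Site (3 + 1)), τ κ y (lam μ z) = τ κ (y - z) (lam μ 0))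
    (hSW : ∀ (ν κ : Fin (3 + 1)) (w : Site (3 + 1)), w ∉ W → S ν 0 κ w = 0)
    (hτW : ∀ (κ μ : Fin (3 + 1)) (w : Site (3 + 1)), w ∉ W → τ κ w (lam μ 0) = 0)
    -- (U) no door word on the summed gauge column (LEMMA U's conclusion; K2L-LAM by value)
    (hΘ : ∀ (κ μ : Fin (3 + 1)), ∑ y ∈ W, τ κ y (lam μ 0) = 0)
    -- (C) every read-out column is a co-closed lattice 1-form on `Y` (LEMMA C's conclusion)
    (hdiv : ∀ (ν : Fin (3 + 1)), ∀ y ∈ Y, ∑ κ, (S ν 0 κ y - S ν 0 κ (y - e κ)) = 0)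
    -- (R) reflection parities of the read-out columns (LEMMA R's conclusion)
    (R : Fin (3 + 1) → Fin (3 + 1) → Site (3 + 1) ≃ Site (3 + 1)) (k : Fin (3 + 1) → Fin (3 + 1) → ℝ)
    (hRW : ∀ (ν ρ : Fin (3 + 1)), ρ ≠ ν → ∀ w, w ∈ W ↔ R ν ρ w ∈ W)
    (hRA : ∀ (ν ρ : Fin (3 + 1)), ρ ≠ ν → ∀ κ, κ ≠ ρ → ∀ w, S ν 0 κ (R ν ρ w) = S ν 0 κ w)
    (hRc : ∀ (ν ρ : Fin (3 + 1)), ρ ≠ ν → ∀ w, c ρ (R ν ρ w) = k ν ρ - c ρ w)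
    -- THE IDENTIFICATION ((T2)'s shape): the base door tadpole IS the window pairing
    (hX : ∀ (μ ν : Fin (3 + 1)) (z : Site (3 + 1)),
      tadpole (AN (Roots.ctr Lc) 1) (𝒲Δ 1 μ 0 ν z) = ∑ κ, ∑ y ∈ W, (S ν z κ y * τ κ y (lam μ 0) + S μ 0 κ y * τ κ y (lam ν z))) :
    D1Tel Lc (JsB12CombShSym hLc N (symTablesAn1S2 3 Lc cΛ) cΛ cB) (JcComp hLc N cΛ cB (Roots.ctr Lc) P) := by
  -- (C): column sums of every read-out column vanish; (C)+(R): every read-out dipole vanishes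
  have hS0 : ∀ (ν κ : Fin (3 + 1)), ∑ w ∈ W, S ν 0 κ w = 0 := fun ν κ =>
    colSum_eq_zero_of_coclosed e (fun κ' w => S ν 0 κ' w) W Y (hSW ν) hWY hWY' (hdiv ν) (c κ) κ (hce κ)
  have hS1 : ∀ (ρ ν κ : Fin (3 + 1)), ∑ w ∈ W, c ρ w * S ν 0 κ w = 0 := fun ρ ν κ =>
    dipoles_eq_zero_of_coclosed_of_reflect e (fun κ' w => S ν 0 κ' w) W Y (hSW ν) hWY hWY' (hdiv ν) c (fun ρ' κ' => hce ρ' κ') ν (R ν)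
      (hRW ν) (hRA ν) (k ν) (hRc ν) ρ κ
  refine d1Tel_JcComp_ctr_nested_of_fedW_moments_fed_wStep hLc N cΛ cB P AF 𝒱F 𝒲F AG 𝒱G 𝒲G 𝒲Δ hWΔ₂ hlawΔ hF₁ htrΔ hG hT0 hT1 hDΔtr
    (fun μ ν => tsum_tadpole_eq_zero_of_hasSum (hasSum_zerothMoment_symPairing W Z hZ S τ lam hS hτ hSW hτW hΘ μ ν) (hX μ ν))
    (fun μ ν ρ => ?_) (fun κ l μ ν => ?_)
  · have h := hasSum_firstMoment_symPairing_of_colSums_eq_zero W Z hZ S τ lam hS hτ hSW hτW hΘ hS0 (c ρ) μ ν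
    simp only [hcz] at h
    exact tsum_weight_tadpole_eq_zero_of_hasSum h (hX μ ν)
  · have h := hasSum_secondMoment_symPairing_of_dipoles_eq_zero W Z hZ S τ lam hS hτ hSW hτW hΘ hS0 (c κ) (c l) (hS1 κ) (hS1 l) μ ν
    simp only [hcz] at h
    exact tsum_weight_tadpole_eq_zero_of_hasSum h (hX μ ν)

/-- [folklore] **THE READ-OUT-LEVEL TWIN** (channel `(μ, ν)`): the same rows ⟹ the lead's `D1Sum Lc Js (JcComp … (Roots.ctr Lc) P) μ ν` (the (1.22) component is the
`(c μ, c ν)` instance of PART 42's second-moment row). -/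
theorem d1Sum_JcComp_ctr_nested_of_fedW_pairing_fed_wStep (hLc : Odd Lc) (N : ℕ) (cΛ cB : ℝ) (P : Pins)
    (AF : ℕ → MKer 4 FF) (𝒱F : ℕ → Fin 4 → (Fin 4 → ℤ) → MKer 4 FF) (𝒲F : ℕ → Fin 4 → (Fin 4 → ℤ) → Fin 4 → (Fin 4 → ℤ) → MKer 4 FF)
    (AG : ℕ → MKer 4 FG) (𝒱G : ℕ → Fin 4 → (Fin 4 → ℤ) → MKer 4 FG) (𝒲G : ℕ → Fin 4 → (Fin 4 → ℤ) → Fin 4 → (Fin 4 → ℤ) → MKer 4 FG)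
    (𝒲Δ : ℕ → Fin (3 + 1) → Site (3 + 1) → Fin (3 + 1) → Site (3 + 1) → MKer (3 + 1) (Fib 3))
    (hWΔ₂ : ∀ j : ℕ, ∃ Cw δw : ℝ, 0 < δw ∧ VertexFamily₂ (𝒲Δ j) (Lc ^ (j + 1)) Cw δw) (μ ν : Fin 4)
    (hlawΔ : ∀ j : ℕ, 1 ≤ j → ∀ (μ ν : Fin 4) (z : Fin 4 → ℤ),
      hessKer (AN (Roots.ctr Lc) j) (VN (Roots.ctr Lc) P j) (WN (Roots.ctr Lc) P j + 𝒲Δ j) μ ν z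
        = hessKer (AF j) (𝒱F j) (𝒲F j) μ ν z + hessKer (AG j) (𝒱G j) (𝒲G j) μ ν z)
    (hF₁ : ∀ (μ ν : Fin 4) (z : Fin 4 → ℤ),
      hessKer (AF 1) (𝒱F 1) (𝒲F 1) μ ν z
        = (Lc : ℝ) ^ 8 * dressedEntry (wStep Lc 1) (TshotOf Lc (JcComp hLc N cΛ cB (Roots.ctr Lc) P) 1) ((Lc : ℤ) • z) μ ν)
    (htrΔ : ∀ j : ℕ, 1 ≤ j → ∀ (μ ν : Fin 4) (z : Fin 4 → ℤ),
      hessKer (AF (j + 1)) (𝒱F (j + 1)) (𝒲F (j + 1)) μ ν z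
        = (Lc : ℝ) ^ 8 * dressedEntry (wStep Lc (j + 1))
            (hessKer (AN (Roots.ctr Lc) j) (VN (Roots.ctr Lc) P j) (WN (Roots.ctr Lc) P j + 𝒲Δ j)) ((Lc : ℤ) • z) μ ν)
    (hG : ∀ j : ℕ, 1 ≤ j → ∀ (μ ν : Fin 4) (z : Fin 4 → ℤ),
      hessKer (AG j) (𝒱G j) (𝒲G j) μ ν z = TbalOf Lc (JsB12CombShSym hLc N (symTablesAn1S2 3 Lc cΛ) cΛ cB) j μ ν z)
    (hT0 : ∀ j (c e : Fin 4), HasSum (TbalOf Lc (JsB12CombShSym hLc N (symTablesAn1S2 3 Lc cΛ) cΛ cB) j c e) 0)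
    (hT1 : ∀ j (c e ρ : Fin 4), HasSum (fun t : Fin 4 → ℤ => t ρ • TbalOf Lc (JsB12CombShSym hLc N (symTablesAn1S2 3 Lc cΛ) cΛ cB) j c e t) 0)
    (hDΔtr : ∀ j : ℕ, 1 ≤ j → ∀ (μ ν : Fin 4) (z : Fin 4 → ℤ),
      -(1 / 2 : ℝ) * tadpole (AN (Roots.ctr Lc) (j + 1)) (𝒲Δ (j + 1) μ 0 ν z)
        = (Lc : ℝ) ^ 8 * dressedEntry (wStep Lc (j + 1))
            (fun c e t => -(1 / 2 : ℝ) * tadpole (AN (Roots.ctr Lc) j) (𝒲Δ j c 0 e t)) ((Lc : ℤ) • z) μ ν)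
    (S : Fin (3 + 1) → Site (3 + 1) → Fin (3 + 1) → Site (3 + 1) → ℝ) (τ : Fin (3 + 1) → Site (3 + 1) → V →ₗ[ℝ] ℝ) (lam : Fin (3 + 1) → Site (3 + 1) → V)
    (W Z Y : Finset (Site (3 + 1))) (hZ : ∀ y ∈ W, ∀ w ∈ W, y - w ∈ Z) (hWY : ∀ w ∈ W, w ∈ Y)
    (e : Fin (3 + 1) → Site (3 + 1)) (hWY' : ∀ (κ : Fin (3 + 1)), ∀ w ∈ W, w + e κ ∈ Y)
    (c : Fin (3 + 1) → Site (3 + 1) →+ ℝ) (hcz : ∀ (ρ : Fin (3 + 1)) (z : Site (3 + 1)), c ρ z = (z ρ : ℝ))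
    (hce : ∀ (ρ κ : Fin (3 + 1)), c ρ (e κ) = if κ = ρ then 1 else 0)
    (hS : ∀ (ν : Fin (3 + 1)) (z : Site (3 + 1)) (κ : Fin (3 + 1)) (y : Site (3 + 1)), S ν z κ y = S ν 0 κ (y - z))
    (hτ : ∀ (κ : Fin (3 + 1)) (y : Site (3 + 1)) (μ : Fin (3 + 1)) (z : Site (3 + 1)), τ κ y (lam μ z) = τ κ (y - z) (lam μ 0))
    (hSW : ∀ (ν κ : Fin (3 + 1)) (w : Site (3 + 1)), w ∉ W → S ν 0 κ w = 0)
    (hτW : ∀ (κ μ : Fin (3 + 1)) (w : Site (3 + 1)), w ∉ W → τ κ w (lam μ 0) = 0)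
    (hΘ : ∀ (κ μ : Fin (3 + 1)), ∑ y ∈ W, τ κ y (lam μ 0) = 0)
    (hdiv : ∀ (ν : Fin (3 + 1)), ∀ y ∈ Y, ∑ κ, (S ν 0 κ y - S ν 0 κ (y - e κ)) = 0)
    (R : Fin (3 + 1) → Fin (3 + 1) → Site (3 + 1) ≃ Site (3 + 1)) (k : Fin (3 + 1) → Fin (3 + 1) → ℝ)
    (hRW : ∀ (ν ρ : Fin (3 + 1)), ρ ≠ ν → ∀ w, w ∈ W ↔ R ν ρ w ∈ W)
    (hRA : ∀ (ν ρ : Fin (3 + 1)), ρ ≠ ν → ∀ κ, κ ≠ ρ → ∀ w, S ν 0 κ (R ν ρ w) = S ν 0 κ w)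
    (hRc : ∀ (ν ρ : Fin (3 + 1)), ρ ≠ ν → ∀ w, c ρ (R ν ρ w) = k ν ρ - c ρ w)
    (hX : ∀ (μ ν : Fin (3 + 1)) (z : Site (3 + 1)),
      tadpole (AN (Roots.ctr Lc) 1) (𝒲Δ 1 μ 0 ν z) = ∑ κ, ∑ y ∈ W, (S ν z κ y * τ κ y (lam μ 0) + S μ 0 κ y * τ κ y (lam ν z))) :
    D1Sum Lc (JsB12CombShSym hLc N (symTablesAn1S2 3 Lc cΛ) cΛ cB) (JcComp hLc N cΛ cB (Roots.ctr Lc) P) μ ν := by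
  have hS0 : ∀ (ν κ : Fin (3 + 1)), ∑ w ∈ W, S ν 0 κ w = 0 := fun ν κ =>
    colSum_eq_zero_of_coclosed e (fun κ' w => S ν 0 κ' w) W Y (hSW ν) hWY hWY' (hdiv ν) (c κ) κ (hce κ)
  have hS1 : ∀ (ρ ν κ : Fin (3 + 1)), ∑ w ∈ W, c ρ w * S ν 0 κ w = 0 := fun ρ ν κ =>
    dipoles_eq_zero_of_coclosed_of_reflect e (fun κ' w => S ν 0 κ' w) W Y (hSW ν) hWY hWY' (hdiv ν) c (fun ρ' κ' => hce ρ' κ') ν (R ν)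
      (hRW ν) (hRA ν) (k ν) (hRc ν) ρ κ
  refine d1Sum_JcComp_ctr_nested_of_fedW_moments_fed_wStep hLc N cΛ cB P AF 𝒱F 𝒲F AG 𝒱G 𝒲G 𝒲Δ hWΔ₂ μ ν hlawΔ hF₁ htrΔ hG hT0 hT1 hDΔtr
    (fun μ' ν' => tsum_tadpole_eq_zero_of_hasSum (hasSum_zerothMoment_symPairing W Z hZ S τ lam hS hτ hSW hτW hΘ μ' ν') (hX μ' ν'))
    (fun μ' ν' ρ => ?_) ?_
  · have h := hasSum_firstMoment_symPairing_of_colSums_eq_zero W Z hZ S τ lam hS hτ hSW hτW hΘ hS0 (c ρ) μ' ν'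
    simp only [hcz] at h
    exact tsum_weight_tadpole_eq_zero_of_hasSum h (hX μ' ν')
  · have h := hasSum_secondMoment_symPairing_of_dipoles_eq_zero W Z hZ S τ lam hS hτ hSW hτW hΘ hS0 (c μ) (c ν) (hS1 μ) (hS1 ν) μ ν
    simp only [hcz] at h
    exact tsum_weight_tadpole_eq_zero_of_hasSum h (hX μ ν)

end BasePairing

/-! ## §3 (v1.1) Per-storey shape: the pairing data and the letters (U)(C)(R) at EVERY storey — no covariance row, no G3 -/

section PerStoreyPairing

variable {Lc : ℕ} [NeZero Lc] {FF FG : Type*} [Fintype FF] [Fintype FG]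
variable {V : ℕ → Type*} [∀ j, AddCommGroup (V j)] [∀ j, Module ℝ (V j)]

/-- [folklore] **ROOT M‴'s `htel` AT THE RECORD PAIR, THE DOOR A LOCALISED FAMILY, ITS TADPOLE AT EVERY STOREY DISPLAYED AS A COVARIANT SYMMETRISED PAIRING UNDER (U)(C)(R)**
(`…CompDoorMoments` §2 shape: NO fed transport of the door, NO covariance row `hDΔtr` — the steps are read storey by storey).  DISPLAYED: `𝒲Δ`, `hWΔ₂`, `hlawΔ`, #31's `hF₁ htr hG`
(T0)(T1) VERBATIM from p659244 §2; and AT EVERY STOREY `j ≥ 1`: pairing data `S j`, `τ j`, `lam j` (gauge-column space `V j`), windows `W j ⊆ Y j`, `Z j ⊇ W j − W j`, unit steps `e`,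
coordinates `c ρ` (`hcz`, `hce`), covariance `hS hτ`, supports `hSW hτW`, (U) `hΘ`, (C) `hdiv`, (R) `hRW hRA hRc`, and the identification `hX j` ⟹ `D1Tel Lc Js (JcComp hLc N cΛ cB R P)`. -/
theorem d1Tel_JcComp_nested_of_fedW_pairing_wStep (hLc : Odd Lc) (N : ℕ) (cΛ cB : ℝ) (Rt : Roots Lc) (P : Pins)
    (AF : ℕ → MKer 4 FF) (𝒱F : ℕ → Fin 4 → (Fin 4 → ℤ) → MKer 4 FF) (𝒲F : ℕ → Fin 4 → (Fin 4 → ℤ) → Fin 4 → (Fin 4 → ℤ) → MKer 4 FF)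
    (AG : ℕ → MKer 4 FG) (𝒱G : ℕ → Fin 4 → (Fin 4 → ℤ) → MKer 4 FG) (𝒲G : ℕ → Fin 4 → (Fin 4 → ℤ) → Fin 4 → (Fin 4 → ℤ) → MKer 4 FG)
    (𝒲Δ : ℕ → Fin (3 + 1) → Site (3 + 1) → Fin (3 + 1) → Site (3 + 1) → MKer (3 + 1) (Fib 3))
    (hWΔ₂ : ∀ j : ℕ, ∃ Cw δw : ℝ, 0 < δw ∧ VertexFamily₂ (𝒲Δ j) (Lc ^ (j + 1)) Cw δw)
    (hlawΔ : ∀ j : ℕ, 1 ≤ j → ∀ (μ ν : Fin 4) (z : Fin 4 → ℤ),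
      hessKer (AN Rt j) (VN Rt P j) (WN Rt P j + 𝒲Δ j) μ ν z
        = hessKer (AF j) (𝒱F j) (𝒲F j) μ ν z + hessKer (AG j) (𝒱G j) (𝒲G j) μ ν z)
    (hF₁ : ∀ (μ ν : Fin 4) (z : Fin 4 → ℤ),
      hessKer (AF 1) (𝒱F 1) (𝒲F 1) μ ν z
        = (Lc : ℝ) ^ 8 * dressedEntry (wStep Lc 1) (TshotOf Lc (JcComp hLc N cΛ cB Rt P) 1) ((Lc : ℤ) • z) μ ν)
    (htr : ∀ j : ℕ, 1 ≤ j → ∀ (μ ν : Fin 4) (z : Fin 4 → ℤ),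
      hessKer (AF (j + 1)) (𝒱F (j + 1)) (𝒲F (j + 1)) μ ν z
        = (Lc : ℝ) ^ 8 * dressedEntry (wStep Lc (j + 1)) (hessKer (AN Rt j) (VN Rt P j) (WN Rt P j)) ((Lc : ℤ) • z) μ ν)
    (hG : ∀ j : ℕ, 1 ≤ j → ∀ (μ ν : Fin 4) (z : Fin 4 → ℤ),
      hessKer (AG j) (𝒱G j) (𝒲G j) μ ν z = TbalOf Lc (JsB12CombShSym hLc N (symTablesAn1S2 3 Lc cΛ) cΛ cB) j μ ν z)
    (hT0 : ∀ j (c e : Fin 4), HasSum (TbalOf Lc (JsB12CombShSym hLc N (symTablesAn1S2 3 Lc cΛ) cΛ cB) j c e) 0)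
    (hT1 : ∀ j (c e ρ : Fin 4), HasSum (fun t : Fin 4 → ℤ => t ρ • TbalOf Lc (JsB12CombShSym hLc N (symTablesAn1S2 3 Lc cΛ) cΛ cB) j c e t) 0)
    -- THE DOOR TADPOLE AS A COVARIANT SYMMETRISED PAIRING, STOREY BY STOREY
    (S : ℕ → Fin (3 + 1) → Site (3 + 1) → Fin (3 + 1) → Site (3 + 1) → ℝ) (τ : ∀ j : ℕ, Fin (3 + 1) → Site (3 + 1) → V j →ₗ[ℝ] ℝ)
    (lam : ∀ j : ℕ, Fin (3 + 1) → Site (3 + 1) → V j)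
    (W Z Y : ℕ → Finset (Site (3 + 1))) (hZ : ∀ j, ∀ y ∈ W j, ∀ w ∈ W j, y - w ∈ Z j) (hWY : ∀ j, ∀ w ∈ W j, w ∈ Y j)
    (e : Fin (3 + 1) → Site (3 + 1)) (hWY' : ∀ j (κ : Fin (3 + 1)), ∀ w ∈ W j, w + e κ ∈ Y j)
    (c : Fin (3 + 1) → Site (3 + 1) →+ ℝ) (hcz : ∀ (ρ : Fin (3 + 1)) (z : Site (3 + 1)), c ρ z = (z ρ : ℝ))
    (hce : ∀ (ρ κ : Fin (3 + 1)), c ρ (e κ) = if κ = ρ then 1 else 0)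
    (hS : ∀ j (ν : Fin (3 + 1)) (z : Site (3 + 1)) (κ : Fin (3 + 1)) (y : Site (3 + 1)), S j ν z κ y = S j ν 0 κ (y - z))
    (hτ : ∀ j (κ : Fin (3 + 1)) (y : Site (3 + 1)) (μ : Fin (3 + 1)) (z : Site (3 + 1)), τ j κ y (lam j μ z) = τ j κ (y - z) (lam j μ 0))
    (hSW : ∀ j (ν κ : Fin (3 + 1)) (w : Site (3 + 1)), w ∉ W j → S j ν 0 κ w = 0)
    (hτW : ∀ j (κ μ : Fin (3 + 1)) (w : Site (3 + 1)), w ∉ W j → τ j κ w (lam j μ 0) = 0)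
    (hΘ : ∀ j (κ μ : Fin (3 + 1)), ∑ y ∈ W j, τ j κ y (lam j μ 0) = 0)
    (hdiv : ∀ j (ν : Fin (3 + 1)), ∀ y ∈ Y j, ∑ κ, (S j ν 0 κ y - S j ν 0 κ (y - e κ)) = 0)
    (R : ℕ → Fin (3 + 1) → Fin (3 + 1) → Site (3 + 1) ≃ Site (3 + 1)) (k : ℕ → Fin (3 + 1) → Fin (3 + 1) → ℝ)
    (hRW : ∀ j (ν ρ : Fin (3 + 1)), ρ ≠ ν → ∀ w, w ∈ W j ↔ R j ν ρ w ∈ W j)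
    (hRA : ∀ j (ν ρ : Fin (3 + 1)), ρ ≠ ν → ∀ κ, κ ≠ ρ → ∀ w, S j ν 0 κ (R j ν ρ w) = S j ν 0 κ w)
    (hRc : ∀ j (ν ρ : Fin (3 + 1)), ρ ≠ ν → ∀ w, c ρ (R j ν ρ w) = k j ν ρ - c ρ w)
    (hX : ∀ j : ℕ, 1 ≤ j → ∀ (μ ν : Fin (3 + 1)) (z : Site (3 + 1)),
      tadpole (AN Rt j) (𝒲Δ j μ 0 ν z) = ∑ κ, ∑ y ∈ W j, (S j ν z κ y * τ j κ y (lam j μ 0) + S j μ 0 κ y * τ j κ y (lam j ν z))) :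
    D1Tel Lc (JsB12CombShSym hLc N (symTablesAn1S2 3 Lc cΛ) cΛ cB) (JcComp hLc N cΛ cB Rt P) := by
  have hS0 : ∀ j (ν κ : Fin (3 + 1)), ∑ w ∈ W j, S j ν 0 κ w = 0 := fun j ν κ =>
    colSum_eq_zero_of_coclosed e (fun κ' w => S j ν 0 κ' w) (W j) (Y j) (hSW j ν) (hWY j) (hWY' j) (hdiv j ν) (c κ) κ (hce κ)
  have hS1 : ∀ j (ρ ν κ : Fin (3 + 1)), ∑ w ∈ W j, c ρ w * S j ν 0 κ w = 0 := fun j ρ ν κ =>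
    dipoles_eq_zero_of_coclosed_of_reflect e (fun κ' w => S j ν 0 κ' w) (W j) (Y j) (hSW j ν) (hWY j) (hWY' j) (hdiv j ν) c
      (fun ρ' κ' => hce ρ' κ') ν (R j ν) (hRW j ν) (hRA j ν) (k j ν) (hRc j ν) ρ κ
  refine StepRecursionFeedNestedCompDoorMoments.d1Tel_JcComp_nested_of_fedW_moments_wStep hLc N cΛ cB Rt P AF 𝒱F 𝒲F AG 𝒱G 𝒲G 𝒲Δ hWΔ₂ hlawΔ
    hF₁ htr hG hT0 hT1
    (fun j hj μ ν => tsum_tadpole_eq_zero_of_hasSum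
      (hasSum_zerothMoment_symPairing (W j) (Z j) (hZ j) (S j) (τ j) (lam j) (hS j) (hτ j) (hSW j) (hτW j) (hΘ j) μ ν) (hX j hj μ ν))
    (fun j hj μ ν ρ => ?_) (fun j hj κ l μ ν => ?_)
  · have h := hasSum_firstMoment_symPairing_of_colSums_eq_zero (W j) (Z j) (hZ j) (S j) (τ j) (lam j) (hS j) (hτ j) (hSW j) (hτW j)
      (hΘ j) (hS0 j) (c ρ) μ ν
    simp only [hcz] at h
    exact tsum_weight_tadpole_eq_zero_of_hasSum h (hX j hj μ ν)
  · have h := hasSum_secondMoment_symPairing_of_dipoles_eq_zero (W j) (Z j) (hZ j) (S j) (τ j) (lam j) (hS j) (hτ j) (hSW j) (hτW j)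
      (hΘ j) (hS0 j) (c κ) (c l) (hS1 j κ) (hS1 j l) μ ν
    simp only [hcz] at h
    exact tsum_weight_tadpole_eq_zero_of_hasSum h (hX j hj μ ν)

end PerStoreyPairing

end Summit.QuantumFields.BalabanUV.Beta.FP.StepRecursionFeedNestedCompDoorPairing

end
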